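import Mathlib.RingTheory.Henselian
import Mathlib.RingTheory.Unramified.LocalStructure
import Mathlib.RingTheory.Polynomial.UniversalFactorizationRing
import Mathlib.RingTheory.LocalRing.ResidueField.Ideal
import HarnessLib

/-!
# Henselian local rings: sections of pointed étale algebras and lifting of coprime factorisations

Topic `Literature/RingTheory/Henselian`; namespace `Literature.RingTheory.Henselian`.  PROOF FILE (theorems
only; no definition, no named fact, no instance, no `sorry`).  Cell `hodgecm-mathlib` (D-0151), FLOOR-0 P5a
row (S-γ)/(γ1): the structure theory of finite algebras over a henselian local ring [StacksProject, Tag 04GG],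
of which Mathlib has only the DEFINITION `HenselianLocalRing` (= [StacksProject, Def. 10.153.1]: simple roots
of MONIC polynomials lift).  This file proves the first two non-trivial implications of Tag 04GG:

* §1 **`exists_algHom_of_isEtaleAt`** — Tag 04GG (1) ⇒ (8): if `A` is a finitely presented `R`-algebra,
  étale at a prime `Q`, and `φ : A → K` is an `R`-algebra map to a field with kernel `Q` onto which `R`
  surjects (so `κ(Q) = κ`), then `φ` lifts to an `R`-algebra map `τ : A → R` (`algebraMap R K ∘ τ = φ`).
  Proof as printed: localise `A` to a standard étale `R[X][Y]/(f, Yg - 1)` around `Q`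
  (Mathlib `Algebra.IsEtaleAt.exists_isStandardEtale`, Tag 00UE), read the `κ`-point as a simple root of the
  monic `f`, lift it by the henselian property, and map back with `StandardEtalePair.lift`.
  Corollaries `exists_algHom_of_etale` (globally étale `A`) and `exists_algHom_residueField_of_etale`
  (the pointed form with `K = κ(Q)`).
* §2 **`exists_monic_mul_eq_of_isCoprime`** — Tag 04GG (1) ⇒ (4): a factorisation of a monic `p ∈ R[X]`
  into coprime monic factors over a residue field `K` of `R` (any field `K` with `R → K` surjective) lifts
  to a factorisation `p = F * G` into coprime monic factors over `R`.  Proof: Mathlib's universal coprime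
  factorisation algebra gives an ÉTALE `R`-algebra `R'` with a `κ`-rational prime over which the
  factorisation lifts (`Algebra.exists_etale_bijective_residueFieldMap_and_map_eq_mul_and_isCoprime`,
  Tag 00UH); §1 gives a section `R' → R`; push the factorisation forward.

HC_CM is proved only modulo the 7 printed citations until rung 0 closes; this file is generic commutative algebra.

## References
* [StacksProject] The Stacks project, Tag 04GG = Algebra, Lemma 10.153.3 (characterisations of henselian local
  rings), implications (1) ⇒ (8) and (1) ⇒ (4) with their printed proofs; Tag 00UE (étale is locally standard
  étale); Tag 00UH (étale-local lifting of coprime factorisations).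
-/

set_option autoImplicit false

noncomputable section

universe u v w

open Polynomial IsLocalRing

namespace Literature.RingTheory.Henselian

variable {R : Type u} [CommRing R] [HenselianLocalRing R]

/-! ## §0 Residue fields of a local ring presented as surjections `R → K` -/

omit [HenselianLocalRing R] in
/-- If a local ring `R` surjects onto a field `K`, the kernel is the maximal ideal: `algebraMap R K r = 0 ↔ r ∈ 𝔪`.
[folklore] -/
private theorem algebraMap_eq_zero_iff_mem_maximalIdeal [IsLocalRing R] {K : Type w} [Field K] [Algebra R K]
    (hK : Function.Surjective (algebraMap R K)) (r : R) :
    algebraMap R K r = 0 ↔ r ∈ maximalIdeal R := by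
  have hmax : (RingHom.ker (algebraMap R K)).IsMaximal := RingHom.ker_isMaximal_of_surjective _ hK
  rw [← RingHom.mem_ker, IsLocalRing.eq_maximalIdeal hmax]

omit [HenselianLocalRing R] in
/-- If a local ring `R` surjects onto a field `K`, an element is a unit iff its image is non-zero. [folklore] -/
private theorem isUnit_iff_algebraMap_ne_zero [IsLocalRing R] {K : Type w} [Field K] [Algebra R K]
    (hK : Function.Surjective (algebraMap R K)) (r : R) :
    IsUnit r ↔ algebraMap R K r ≠ 0 := by
  rw [ne_eq, algebraMap_eq_zero_iff_mem_maximalIdeal hK, IsLocalRing.mem_maximalIdeal, mem_nonunits_iff,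
    not_not]

omit [HenselianLocalRing R] in
/-- Congruent elements have the same image in a residue field presented as a surjection `R → K`. [folklore] -/
private theorem algebraMap_eq_of_sub_mem_maximalIdeal [IsLocalRing R] {K : Type w} [Field K] [Algebra R K]
    (hK : Function.Surjective (algebraMap R K)) {a b : R} (h : a - b ∈ maximalIdeal R) :
    algebraMap R K a = algebraMap R K b := by
  rw [← sub_eq_zero, ← map_sub, algebraMap_eq_zero_iff_mem_maximalIdeal hK]
  exact h

/-! ## §1 Sections of pointed étale algebras — Tag 04GG (1) ⇒ (8) -/

/-- **Henselian local rings split pointed étale algebras** [Stacks 04GG (1) ⇒ (8)]: let `R` be a henselian local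
ring, `K` a field onto which `R` surjects (a copy of the residue field), `A` a finitely presented `R`-algebra and
`φ : A →ₐ[R] K` with prime kernel `Q` at which `A` is étale.  Then `φ` lifts along `R → K` to an `R`-algebra map
`τ : A →ₐ[R] R`.  Proof (printed): `A_f` is standard étale `≅ R[X][Y]/(f, Yg-1)` for some `f ∉ Q` (Tag 00UE);
the `K`-point `φ` is a root `x₀ ∈ K` of the monic `f` with `g(x₀) ≠ 0`, hence `f'(x₀) ≠ 0`; Hensel lifts it to a
root `a ∈ R`, at which `g` is a unit, giving `R[X][Y]/(f, Yg-1) → R`.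
[cite: StacksProject, Tag 04GG (1)⇒(8), proof] [cite: StacksProject, Tag 00UE] -/
theorem exists_algHom_of_isEtaleAt {A : Type v} [CommRing A] [Algebra R A] [Algebra.FinitePresentation R A]
    {K : Type w} [Field K] [Algebra R K] (hK : Function.Surjective (algebraMap R K))
    (Q : Ideal A) [Q.IsPrime] [Algebra.IsEtaleAt R Q] (φ : A →ₐ[R] K) (hφ : ∀ y, φ y = 0 ↔ y ∈ Q) :
    ∃ τ : A →ₐ[R] R, ∀ y, algebraMap R K (τ y) = φ y := by
  classical
  obtain ⟨f, hfQ, hstd⟩ := Algebra.IsEtaleAt.exists_isStandardEtale (R := R) Q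
  obtain ⟨P⟩ := hstd.nonempty_standardEtalePresentation
  -- extend `φ` to the localisation `A_f`
  have hφf : IsUnit (φ f) := by
    rw [isUnit_iff_ne_zero, ne_eq, hφ]
    exact hfQ
  let φ' : Localization.Away f →ₐ[R] K := IsLocalization.Away.liftAlgHom (S := Localization.Away f) f hφf
  have hφ' : ∀ y : A, φ' (algebraMap A (Localization.Away f) y) = φ y := fun y => by
    change IsLocalization.Away.lift f hφf (algebraMap A _ y) = φ y
    exact IsLocalization.Away.lift_eq f hφf y
  -- the `K`-point of the standard étale algebra and its lift `a₀ ∈ R`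
  let ψ : P.Ring →ₐ[R] K := φ'.comp (P.equivRing.symm : P.Ring →ₐ[R] Localization.Away f)
  have hψX : ψ P.X = φ' P.x := by
    change φ' (P.equivRing.symm P.X) = φ' P.x
    rw [P.equivRing_symm_X]
  have hx₁ : P.HasMap (φ' P.x) := hψX ▸ P.hasMap_X.map ψ
  obtain ⟨a₀, ha₀⟩ := hK (φ' P.x)
  have hfa₀ : P.f.eval a₀ ∈ maximalIdeal R := by
    rw [← algebraMap_eq_zero_iff_mem_maximalIdeal hK, ← aeval_algebraMap_apply_eq_algebraMap_eval, ha₀]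
    exact hx₁.1
  have hf'a₀ : IsUnit (P.f.derivative.eval a₀) := by
    rw [isUnit_iff_algebraMap_ne_zero hK, ← aeval_algebraMap_apply_eq_algebraMap_eval, ha₀]
    exact hx₁.isUnit_derivative_f.ne_zero
  -- Hensel
  obtain ⟨a, hfa, haa₀⟩ := HenselianLocalRing.is_henselian P.f P.monic_f a₀ hfa₀ hf'a₀
  have haK : algebraMap R K a = φ' P.x := by
    rw [algebraMap_eq_of_sub_mem_maximalIdeal hK haa₀, ha₀]
  have hga : IsUnit (P.g.eval a) := by
    rw [isUnit_iff_algebraMap_ne_zero hK, ← aeval_algebraMap_apply_eq_algebraMap_eval, haK]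
    exact hx₁.2.ne_zero
  have ha : P.HasMap a := by
    refine ⟨?_, ?_⟩
    · rw [coe_aeval_eq_eval]
      exact hfa
    · rw [coe_aeval_eq_eval]
      exact hga
  -- the section
  let τ : A →ₐ[R] R := (P.lift a ha).comp
    ((P.equivRing : Localization.Away f →ₐ[R] P.Ring).comp (IsScalarTower.toAlgHom R A (Localization.Away f)))
  have hψ₂ : (Algebra.ofId R K).comp (P.lift a ha) = ψ := by
    refine StandardEtalePair.hom_ext ?_
    rw [AlgHom.comp_apply, StandardEtalePair.lift_X, hψX, Algebra.ofId_apply, haK]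
  refine ⟨τ, fun y => ?_⟩
  have h1 : algebraMap R K (τ y) =
      ((Algebra.ofId R K).comp (P.lift a ha)) (P.equivRing (algebraMap A (Localization.Away f) y)) := rfl
  rw [h1, hψ₂]
  change φ' (P.equivRing.symm (P.equivRing (algebraMap A (Localization.Away f) y))) = φ y
  rw [AlgEquiv.symm_apply_apply, hφ']

/-- **Sections of pointed étale algebras over a henselian local ring** (globally étale form of
`exists_algHom_of_isEtaleAt`): an `R`-algebra map `φ : A → K` from an étale `R`-algebra to a field `K` onto
which `R` surjects lifts to `τ : A →ₐ[R] R`. [cite: StacksProject, Tag 04GG (1)⇒(8)] -/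
theorem exists_algHom_of_etale {A : Type v} [CommRing A] [Algebra R A] [Algebra.Etale R A]
    {K : Type w} [Field K] [Algebra R K] (hK : Function.Surjective (algebraMap R K)) (φ : A →ₐ[R] K) :
    ∃ τ : A →ₐ[R] R, ∀ y, algebraMap R K (τ y) = φ y := by
  haveI : (RingHom.ker φ.toRingHom).IsPrime := RingHom.ker_isPrime _
  haveI : Algebra.FormallyEtale R A := Algebra.Etale.formallyEtale
  haveI : Algebra.FinitePresentation R A := Algebra.Etale.finitePresentation
  haveI : Algebra.IsEtaleAt R (RingHom.ker φ.toRingHom) :=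
    Algebra.FormallyEtale.comp R A (Localization.AtPrime (RingHom.ker φ.toRingHom))
  exact exists_algHom_of_isEtaleAt hK (RingHom.ker φ.toRingHom) φ fun y => Iff.rfl

/-- **Pointed retractions** [Stacks 04GG (8), the printed form]: for an étale `R`-algebra `A` over a henselian
local ring and a prime `Q` of `A` with `R → κ(Q)` surjective (i.e. `Q` lies over `𝔪` with trivial residue
extension) there is `τ : A →ₐ[R] R` with `τ⁻¹(𝔪) = Q`. [cite: StacksProject, Tag 04GG (1)⇒(8)] -/
theorem exists_algHom_comap_eq_of_etale {A : Type v} [CommRing A] [Algebra R A] [Algebra.Etale R A]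
    (Q : Ideal A) [Q.IsPrime] (hQ : Function.Surjective (algebraMap R Q.ResidueField)) :
    ∃ τ : A →ₐ[R] R, (maximalIdeal R).comap τ.toRingHom = Q := by
  obtain ⟨τ, hτ⟩ := exists_algHom_of_etale hQ (IsScalarTower.toAlgHom R A Q.ResidueField)
  refine ⟨τ, Ideal.ext fun y => ?_⟩
  rw [Ideal.mem_comap, AlgHom.toRingHom_eq_coe, RingHom.coe_coe, ← algebraMap_eq_zero_iff_mem_maximalIdeal hQ,
    hτ, IsScalarTower.coe_toAlgHom', Ideal.algebraMap_residueField_eq_zero]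

/-! ## §2 Lifting coprime factorisations — Tag 04GG (1) ⇒ (4) -/

/-- **Hensel's lemma for coprime factorisations over a henselian local ring** [Stacks 04GG (1) ⇒ (4)]: let `R`
be henselian local and `R → K` a surjection onto a field (the residue field).  If a monic `p ∈ R[X]` factors
over `K` as `p̄ = f * g` with `f, g` monic and coprime, then `p = F * G` with `F, G ∈ R[X]` monic and coprime,
`F̄ = f`, `Ḡ = g`.  Proof: the universal coprime-factorisation algebra of `p` is étale over `R` (Tag 00UH, Mathlib
`Algebra.exists_etale_bijective_residueFieldMap_and_map_eq_mul_and_isCoprime`) and carries a `κ`-rational prime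
at the given factorisation; a section through it (§1) specialises the universal factorisation to `R`.
[cite: StacksProject, Tag 04GG (1)⇒(4)] [cite: StacksProject, Tag 00UH] -/
theorem exists_monic_mul_eq_of_isCoprime {K : Type w} [Field K] [Algebra R K]
    (hK : Function.Surjective (algebraMap R K)) (p : R[X]) (hp : p.Monic) (f g : K[X]) (hf : f.Monic)
    (hg : g.Monic) (H : p.map (algebraMap R K) = f * g) (Hc : IsCoprime f g) :
    ∃ F G : R[X], F.Monic ∧ G.Monic ∧ p = F * G ∧ IsCoprime F G ∧
      F.map (algebraMap R K) = f ∧ G.map (algebraMap R K) = g := by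
  classical
  set 𝔪 := maximalIdeal R with h𝔪
  -- transport the factorisation to Mathlib's residue field `κ(𝔪)` along the injective `j : K → κ(𝔪)`
  have hker : RingHom.ker (algebraMap R K) ≤ RingHom.ker (algebraMap R 𝔪.ResidueField) := fun r hr => by
    rw [RingHom.mem_ker] at hr ⊢
    rw [Ideal.algebraMap_residueField_eq_zero]
    exact (algebraMap_eq_zero_iff_mem_maximalIdeal hK r).1 hr
  let j : K →+* 𝔪.ResidueField := RingHom.liftOfSurjective (algebraMap R K) hK ⟨algebraMap R _, hker⟩
  have hj : ∀ r : R, j (algebraMap R K r) = algebraMap R 𝔪.ResidueField r := fun r =>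
    RingHom.liftOfRightInverse_comp_apply _ _ _ _ r
  have hjcomp : j.comp (algebraMap R K) = algebraMap R 𝔪.ResidueField := RingHom.ext hj
  have H₁ : p.map (algebraMap R 𝔪.ResidueField) = f.map j * g.map j := by
    rw [← hjcomp, ← Polynomial.map_map, H, Polynomial.map_mul]
  obtain ⟨R', _, _, _, Q, _, _, F', G', hbij, hF'm, hG'm, hpFG, hcop, hfF', hgG'⟩ :=
    Algebra.exists_etale_bijective_residueFieldMap_and_map_eq_mul_and_isCoprime 𝔪 p (f.map j) (g.map j) hp
      (hf.map j) (hg.map j) H₁ (Hc.map (Polynomial.mapRingHom j))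
  -- the residue map `ι : κ(𝔪) → κ(Q)` (bijective) and the pointed algebra map `φ : R' → κ(Q)`
  set ι := Ideal.ResidueField.mapₐ 𝔪 Q (Algebra.ofId R R') (Ideal.over_def Q 𝔪) with hι
  have hιalg : ∀ r : R, ι (algebraMap R 𝔪.ResidueField r) = algebraMap R Q.ResidueField r := fun r =>
    ι.commutes r
  have hQsurj : Function.Surjective (algebraMap R Q.ResidueField) := fun z => by
    obtain ⟨y, rfl⟩ := hbij.2 z
    obtain ⟨r, rfl⟩ := Ideal.algebraMap_residueField_surjective 𝔪 y
    exact ⟨r, (hιalg r).symm⟩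
  obtain ⟨τ, hτ⟩ := exists_algHom_of_etale hQsurj (IsScalarTower.toAlgHom R R' Q.ResidueField)
  have hτ' : (algebraMap R Q.ResidueField).comp τ.toRingHom = algebraMap R' Q.ResidueField :=
    RingHom.ext fun y => hτ y
  -- push the universal factorisation forward along `τ`
  have hτR : τ.toRingHom.comp (algebraMap R R') = RingHom.id R := τ.comp_algebraMap
  refine ⟨F'.map τ.toRingHom, G'.map τ.toRingHom, hF'm.map _, hG'm.map _, ?_,
    hcop.map (Polynomial.mapRingHom τ.toRingHom), ?_, ?_⟩
  · rw [← Polynomial.map_mul, ← hpFG, Polynomial.map_map, hτR, Polynomial.map_id]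
  -- reductions: compare after the injective map `ι ∘ j : K → κ(Q)`
  · have hinj : Function.Injective (ι.toRingHom.comp j) := (ι.toRingHom.comp j).injective
    refine Polynomial.map_injective _ hinj ?_
    rw [Polynomial.map_map, RingHom.comp_assoc, hjcomp, ← Polynomial.map_map, ← Polynomial.map_map]
    have h2 : (F'.map τ.toRingHom).map (algebraMap R 𝔪.ResidueField) =
        F'.map ((algebraMap R 𝔪.ResidueField).comp τ.toRingHom) := Polynomial.map_map _ _ _
    rw [h2, Polynomial.map_map, ← RingHom.comp_assoc]
    have h3 : ι.toRingHom.comp (algebraMap R 𝔪.ResidueField) = algebraMap R Q.ResidueField :=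
      RingHom.ext fun r => hιalg r
    rw [h3, hτ', ← hfF']
  · have hinj : Function.Injective (ι.toRingHom.comp j) := (ι.toRingHom.comp j).injective
    refine Polynomial.map_injective _ hinj ?_
    rw [Polynomial.map_map, RingHom.comp_assoc, hjcomp, ← Polynomial.map_map, ← Polynomial.map_map]
    have h2 : (G'.map τ.toRingHom).map (algebraMap R 𝔪.ResidueField) =
        G'.map ((algebraMap R 𝔪.ResidueField).comp τ.toRingHom) := Polynomial.map_map _ _ _
    rw [h2, Polynomial.map_map, ← RingHom.comp_assoc]
    have h3 : ι.toRingHom.comp (algebraMap R 𝔪.ResidueField) = algebraMap R Q.ResidueField :=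
      RingHom.ext fun r => hιalg r
    rw [h3, hτ', ← hgG']

/-- **Hensel's lemma for coprime factorisations, residue-field form**: over a henselian local ring `R` with
residue map `residue R : R → κ`, a factorisation of a monic `p` into coprime monic factors over `κ` lifts to a
factorisation `p = F * G` into coprime monic factors over `R` with the given reductions.
[cite: StacksProject, Tag 04GG (1)⇒(4)] -/
theorem exists_monic_mul_eq_of_isCoprime_residue (p : R[X]) (hp : p.Monic) (f g : (ResidueField R)[X])
    (hf : f.Monic) (hg : g.Monic) (H : p.map (residue R) = f * g) (Hc : IsCoprime f g) :
    ∃ F G : R[X], F.Monic ∧ G.Monic ∧ p = F * G ∧ IsCoprime F G ∧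
      F.map (residue R) = f ∧ G.map (residue R) = g :=
  exists_monic_mul_eq_of_isCoprime (K := ResidueField R) IsLocalRing.residue_surjective p hp f g hf hg H Hc

end Literature.RingTheory.Henselian

end
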